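import Literature.NumberTheory.Automorphic.BianchiBoundaryBorel
import Literature.NumberTheory.Automorphic.IwasawaDecompositionAdelic
import Literature.NumberTheory.Automorphic.IdeleIdealClass
import Literature.NumberTheory.Automorphic.QuaternionicFormsClassNumber
import Literature.NumberTheory.Automorphic.UnramifiedLevelChange
import Literature.NumberTheory.Automorphic.GLnAdelicStructureProofs
import HarnessLib

/-!
# Finitely many `B(F)`-orbits on `GL₂(𝔸_F^∞) / K_f(𝔫)` ("finitely many cusps")

Topic `NumberTheory/Automorphic`; namespace `Literature.NumberTheory.Automorphic`, grouping
sub-namespaces `BigHeckeGLn` and `ParallelWeight`.  Theorems only.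

For a number field `F` and a non-zero ideal `𝔫 ⊆ 𝓞_F`:

* `exists_borel_mul_glDiagonal_mul_eq` — **every `g ∈ GL₂(𝔸_F^∞)` is `ι(γ) · diag(t₀, t₁) · c`**
  with `γ ∈ B(F)`, `t₀, t₁` in a fixed finite set `T` of finite ideles (representatives of the
  idele classes modulo `Fˣ 𝒪̂ˣ`, tree `FiniteAdeleRing.exists_finset_forall_exists_unitOrd_eq_zero`,
  finiteness of the class group) and `c ∈ GL₂(𝒪̂_F)`: finite-adelic Iwasawa decomposition
  `g = b k` (tree `exists_blockTriangular_mul_mem_glFiniteIntegralLevel`), `b = diag(x, y) n(w)`,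
  `x = k_x t_x u_x`, `y = k_y t_y u_y`, and strong approximation for the additive group
  (`F` is dense in `𝔸_F^∞`, tree `denseRange_algebraMap_finiteAdeleRing`) to split the
  unipotent part `n(w') = n(β) n(λ r)`, `β ∈ F`, `r ∈ 𝒪̂`;
* `exists_finite_cover_borelOrbits` — hence the `B(F)`-orbits on `GL₂(𝔸_F^∞) / K_f(𝔫)` are
  covered by the finitely many points `diag(t) c K_f(𝔫)`, `t ∈ T², c` in a set of
  representatives of the finite quotient `GL₂(𝒪̂) / K_f(𝔫)` (`K_f(𝔫)` open, `GL₂(𝒪̂)` compact).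

This is the adelic form of the finiteness of the number of cusps of the Bianchi (and Hilbert)
modular groups. [cite: Harder1987, §2]

## References

* G. Harder, *Eisenstein cohomology of arithmetic groups. The case GL₂*, Invent. Math. 89 (1987), §2
  [Harder1987].
* A. Weil, *Basic Number Theory* (1967), Ch. IV §2 [WeilBNT1967].
-/

noncomputable section

open scoped NumberField
open IsDedekindDomain

namespace Literature.NumberTheory.Automorphic

namespace BigHeckeGLn

/-! ### `GL₂` over a commutative ring: triangular elements -/

section CommRing

variable {A : Type*} [CommRing A]

/-- The diagonal entries of an invertible upper triangular `2 × 2` matrix are units. [folklore] -/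
theorem isUnit_diag_of_upperTriangular (b : GL (Fin 2) A)
    (h10 : (b : Matrix (Fin 2) (Fin 2) A) 1 0 = 0) :
    IsUnit ((b : Matrix (Fin 2) (Fin 2) A) 0 0) ∧ IsUnit ((b : Matrix (Fin 2) (Fin 2) A) 1 1) := by
  have hdet : IsUnit (b : Matrix (Fin 2) (Fin 2) A).det := b.isUnit.map Matrix.detMonoidHom
  rw [Matrix.det_fin_two, h10, mul_zero, sub_zero] at hdet
  exact IsUnit.mul_iff.1 hdet

/-- **`b = diag(x, y) n(x⁻¹ z)`** for an invertible upper triangular `b = (x z; 0 y)`. [folklore] -/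
theorem eq_glDiagonal_mul_upperRightHom (b : GL (Fin 2) A)
    (h10 : (b : Matrix (Fin 2) (Fin 2) A) 1 0 = 0) :
    b = glDiagonal 2 A ![(isUnit_diag_of_upperTriangular b h10).1.unit,
        (isUnit_diag_of_upperTriangular b h10).2.unit] *
      Matrix.GeneralLinearGroup.upperRightHom
        (((isUnit_diag_of_upperTriangular b h10).1.unit⁻¹ : Aˣ) * (b : Matrix (Fin 2) (Fin 2) A) 0 1) := by
  ext i j
  rw [Units.val_mul, coe_glDiagonal, Matrix.GeneralLinearGroup.upperRightHom_apply,
    Matrix.diagonal_mul]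
  fin_cases i <;> fin_cases j
  · simp
  · simp [← mul_assoc]
  · simp [h10]
  · simp

/-- **`diag(s) n(w) = n(s₀ w s₁⁻¹) diag(s)`**. [folklore] -/
theorem glDiagonal_mul_upperRightHom (s : Fin 2 → Aˣ) (w : A) :
    glDiagonal 2 A s * Matrix.GeneralLinearGroup.upperRightHom w =
      Matrix.GeneralLinearGroup.upperRightHom ((s 0 : A) * w * ((s 1)⁻¹ : Aˣ)) * glDiagonal 2 A s := by
  ext i j
  rw [Units.val_mul, Units.val_mul, coe_glDiagonal, Matrix.GeneralLinearGroup.upperRightHom_apply,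
    Matrix.GeneralLinearGroup.upperRightHom_apply, Matrix.diagonal_mul, Matrix.mul_diagonal]
  fin_cases i <;> fin_cases j
  · simp
  · simp [mul_assoc]
  · simp
  · simp

/-- `n(x)` is natural in the ring. [folklore] -/
theorem map_upperRightHom_eq {B : Type*} [CommRing B] (f : A →+* B) (x : A) :
    Matrix.GeneralLinearGroup.map f (Matrix.GeneralLinearGroup.upperRightHom x) =
      Matrix.GeneralLinearGroup.upperRightHom (f x) := by
  ext i j
  rw [Matrix.GeneralLinearGroup.map_apply, Matrix.GeneralLinearGroup.upperRightHom_apply,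
    Matrix.GeneralLinearGroup.upperRightHom_apply]
  fin_cases i <;> fin_cases j <;> simp

/-- `map f (diag d) = diag (f ∘ d)`. [folklore] -/
theorem map_glDiagonal_eq {B : Type*} [CommRing B] (f : A →+* B) {n : ℕ} (d : Fin n → Aˣ) :
    Matrix.GeneralLinearGroup.map f (glDiagonal n A d) =
      glDiagonal n B (fun i => Units.map (f : A →* B) (d i)) := by
  ext i j
  rw [Matrix.GeneralLinearGroup.map_apply, coe_glDiagonal, coe_glDiagonal, Matrix.diagonal_apply,
    Matrix.diagonal_apply]
  split_ifs <;> simp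

end CommRing

/-! ### Integral elements of `GL₂(𝔸_F^∞)` -/

variable {K : Type} [Field K] [NumberField K]

/-- `diag(u) ∈ GL_n(𝒪̂)` for ideles `uᵢ` of order `0` everywhere. [folklore] -/
theorem glDiagonal_mem_glFiniteIntegralLevel {n : ℕ} {u : Fin n → (FiniteAdeleRing (𝓞 K) K)ˣ}
    (hu : ∀ i v, FiniteAdeleRing.unitOrd (𝓞 K) K (u i) v = 0) :
    glDiagonal n (FiniteAdeleRing (𝓞 K) K) u ∈ glFiniteIntegralLevel n K := by
  rw [mem_glFiniteIntegralLevel_iff, ← map_inv, coe_glDiagonal, coe_glDiagonal]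
  refine ⟨fun i j => ?_, fun i j => ?_⟩ <;> rw [Matrix.diagonal_apply] <;> split_ifs with h
  · exact mem_integralFiniteAdeles_iff.2 fun v =>
      (FiniteAdeleRing.mem_adicCompletionIntegers_of_unitOrd_eq_zero (hu i v)).1
  · exact zero_mem _
  · exact mem_integralFiniteAdeles_iff.2 fun v =>
      (FiniteAdeleRing.mem_adicCompletionIntegers_of_unitOrd_eq_zero (hu i v)).2
  · exact zero_mem _

/-- `n(r) ∈ GL₂(𝒪̂)` for `r ∈ 𝒪̂`. [folklore] -/
theorem upperRightHom_mem_glFiniteIntegralLevel {r : FiniteAdeleRing (𝓞 K) K}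
    (hr : r ∈ integralFiniteAdeles K) :
    Matrix.GeneralLinearGroup.upperRightHom r ∈ glFiniteIntegralLevel 2 K := by
  rw [mem_glFiniteIntegralLevel_iff, ← AddChar.map_neg_eq_inv,
    Matrix.GeneralLinearGroup.upperRightHom_apply, Matrix.GeneralLinearGroup.upperRightHom_apply]
  refine ⟨fun i j => ?_, fun i j => ?_⟩ <;> fin_cases i <;> fin_cases j <;>
    simp [hr, neg_mem hr, one_mem, zero_mem]

/-- **Strong approximation for the additive group, multiplicative form**: every finite adele
is `β + λ r` with `β ∈ K`, `r ∈ 𝒪̂`, for any finite idele `λ`. [cite: WeilBNT1967, Ch. IV §2] -/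
theorem exists_eq_algebraMap_add_mul (lam : (FiniteAdeleRing (𝓞 K) K)ˣ) (w : FiniteAdeleRing (𝓞 K) K) :
    ∃ β : K, ∃ r ∈ integralFiniteAdeles K,
      w = algebraMap K (FiniteAdeleRing (𝓞 K) K) β + lam * r := by
  set S : Set (FiniteAdeleRing (𝓞 K) K) :=
    (fun a => ((lam⁻¹ : (FiniteAdeleRing (𝓞 K) K)ˣ) : FiniteAdeleRing (𝓞 K) K) * (w - a)) ⁻¹'
      (integralFiniteAdeles K : Set (FiniteAdeleRing (𝓞 K) K)) with hS
  have hSo : IsOpen S :=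
    (isOpen_integralFiniteAdeles K).preimage ((continuous_const.sub continuous_id).const_mul _)
  have hw : w ∈ S := by
    change ((lam⁻¹ : (FiniteAdeleRing (𝓞 K) K)ˣ) : FiniteAdeleRing (𝓞 K) K) * (w - w) ∈
      (integralFiniteAdeles K : Set (FiniteAdeleRing (𝓞 K) K))
    rw [sub_self, mul_zero]
    exact (integralFiniteAdeles K).zero_mem
  obtain ⟨β, hβS⟩ := (denseRange_algebraMap_finiteAdeleRing (𝓞 K) K).exists_mem_open hSo ⟨w, hw⟩
  refine ⟨β, _, hβS, ?_⟩
  change w = _ + (lam : FiniteAdeleRing (𝓞 K) K) *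
    (((lam⁻¹ : (FiniteAdeleRing (𝓞 K) K)ˣ) : FiniteAdeleRing (𝓞 K) K) * (w - algebraMap K _ β))
  rw [← mul_assoc, Units.mul_inv, one_mul, add_sub_cancel]

/-! ### The decomposition `g = ι(γ) diag(t) c` -/

/-- `ι(diag(k)) = diag(ι k)`. [folklore] -/
theorem globalEmbedding_glDiagonal {n : ℕ} (k : Fin n → Kˣ) :
    globalEmbedding n K (glDiagonal n K k) =
      glDiagonal n (FiniteAdeleRing (𝓞 K) K)
        (fun i => IsDedekindDomain.FiniteAdeleRing.unitEmbedding (𝓞 K) K (k i)) :=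
  map_glDiagonal_eq _ k

/-- `ι(n(β)) = n(β)`. [folklore] -/
theorem globalEmbedding_upperRightHom (β : K) :
    globalEmbedding 2 K (Matrix.GeneralLinearGroup.upperRightHom β) =
      Matrix.GeneralLinearGroup.upperRightHom (algebraMap K (FiniteAdeleRing (𝓞 K) K) β) :=
  map_upperRightHom_eq _ β

/-- **Every `g ∈ GL₂(𝔸_K^∞)` is `ι(γ) diag(t) c`** with `γ ∈ B(K)` (upper triangular),
`t₀, t₁` in a fixed finite set of ideles and `c ∈ GL₂(𝒪̂)`. [cite: Harder1987, §2] -/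
theorem exists_borel_mul_glDiagonal_mul_eq :
    ∃ T : Finset (FiniteAdeleRing (𝓞 K) K)ˣ, ∀ g : FiniteAdelicGL 2 K,
      ∃ γ : GL (Fin 2) K, (γ : Matrix (Fin 2) (Fin 2) K) 1 0 = 0 ∧
      ∃ t₀ ∈ T, ∃ t₁ ∈ T, ∃ c ∈ glFiniteIntegralLevel 2 K,
        g = globalEmbedding 2 K γ * glDiagonal 2 (FiniteAdeleRing (𝓞 K) K) ![t₀, t₁] * c := by
  classical
  obtain ⟨T, hT⟩ := FiniteAdeleRing.exists_finset_forall_exists_unitOrd_eq_zero (R := 𝓞 K) (K := K)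
  refine ⟨T, fun g => ?_⟩
  -- Iwasawa decomposition `g = b kk`
  obtain ⟨b, kk, hb, hkk, rfl⟩ := exists_blockTriangular_mul_mem_glFiniteIntegralLevel (n := 2) (K := K) g
  have h10 : (b : Matrix (Fin 2) (Fin 2) (FiniteAdeleRing (𝓞 K) K)) 1 0 = 0 :=
    hb (show (id 0 : Fin 2) < id 1 by decide)
  -- `b = diag(x, y) n(w)`
  set ux := (isUnit_diag_of_upperTriangular b h10).1.unit with hux
  set uy := (isUnit_diag_of_upperTriangular b h10).2.unit with huy
  set w : FiniteAdeleRing (𝓞 K) K := ((ux⁻¹ : (FiniteAdeleRing (𝓞 K) K)ˣ) : FiniteAdeleRing (𝓞 K) K) *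
    (b : Matrix (Fin 2) (Fin 2) (FiniteAdeleRing (𝓞 K) K)) 0 1 with hw
  have hbeq : b = glDiagonal 2 _ ![ux, uy] * Matrix.GeneralLinearGroup.upperRightHom w :=
    eq_glDiagonal_mul_upperRightHom b h10
  -- idele class representatives `x = kx tx vx`, `y = ky ty vy`
  obtain ⟨tx, htx, kx, hvx⟩ := hT ux
  obtain ⟨ty, hty, ky, hvy⟩ := hT uy
  set vx := ux * tx⁻¹ * (IsDedekindDomain.FiniteAdeleRing.unitEmbedding (𝓞 K) K kx)⁻¹ with hvxdef
  set vy := uy * ty⁻¹ * (IsDedekindDomain.FiniteAdeleRing.unitEmbedding (𝓞 K) K ky)⁻¹ with hvydef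
  have hx : ux = IsDedekindDomain.FiniteAdeleRing.unitEmbedding (𝓞 K) K kx * tx * vx := by
    rw [hvxdef]; simp only [mul_comm, mul_left_comm, mul_assoc, mul_inv_cancel, mul_one,
      mul_inv_cancel_left]
  have hy : uy = IsDedekindDomain.FiniteAdeleRing.unitEmbedding (𝓞 K) K ky * ty * vy := by
    rw [hvydef]; simp only [mul_comm, mul_left_comm, mul_assoc, mul_inv_cancel, mul_one,
      mul_inv_cancel_left]
  have hdiag : (![ux, uy] : Fin 2 → (FiniteAdeleRing (𝓞 K) K)ˣ) =
      (fun i => IsDedekindDomain.FiniteAdeleRing.unitEmbedding (𝓞 K) K (![kx, ky] i)) *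
        (![tx, ty] * ![vx, vy]) := by
    funext i
    fin_cases i
    · simpa [mul_assoc] using hx
    · simpa [mul_assoc] using hy
  -- the diagonal idele `s = t v` and the conjugated unipotent parameter
  obtain ⟨s, hs⟩ : ∃ s : Fin 2 → (FiniteAdeleRing (𝓞 K) K)ˣ, s = ![tx, ty] * ![vx, vy] := ⟨_, rfl⟩
  set w' : FiniteAdeleRing (𝓞 K) K := (s 0 : FiniteAdeleRing (𝓞 K) K) * w * ((s 1)⁻¹ : (FiniteAdeleRing (𝓞 K) K)ˣ)
    with hw'
  -- strong approximation: `w' = β + λ r`, `λ = s₀ s₁⁻¹`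
  obtain ⟨β, r, hr, hw'eq⟩ := exists_eq_algebraMap_add_mul (s 0 * (s 1)⁻¹) w'
  -- the global element and the integral element
  refine ⟨glDiagonal 2 K ![kx, ky] * Matrix.GeneralLinearGroup.upperRightHom β, ?_, tx, htx, ty, hty,
    glDiagonal 2 _ ![vx, vy] * Matrix.GeneralLinearGroup.upperRightHom r * kk, ?_, ?_⟩
  · rw [Units.val_mul, coe_glDiagonal, Matrix.GeneralLinearGroup.upperRightHom_apply,
      Matrix.diagonal_mul]
    simp
  · refine mul_mem (mul_mem (glDiagonal_mem_glFiniteIntegralLevel fun i v => ?_)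
      (upperRightHom_mem_glFiniteIntegralLevel hr)) hkk
    fin_cases i
    · exact hvx v
    · exact hvy v
  · -- `b kk = ι(diag k) n(β) · diag(t) · diag(v) n(r) kk`
    rw [hbeq, hdiag, ← hs, map_mul (glDiagonal 2 (FiniteAdeleRing (𝓞 K) K)),
      map_mul (globalEmbedding 2 K), globalEmbedding_glDiagonal, globalEmbedding_upperRightHom]
    have hn : Matrix.GeneralLinearGroup.upperRightHom w' =
        Matrix.GeneralLinearGroup.upperRightHom (algebraMap K (FiniteAdeleRing (𝓞 K) K) β) *
          Matrix.GeneralLinearGroup.upperRightHom (((s 0 * (s 1)⁻¹ : (FiniteAdeleRing (𝓞 K) K)ˣ) :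
            FiniteAdeleRing (𝓞 K) K) * r) := by
      rw [← AddChar.map_add_eq_mul, ← hw'eq]
    -- `diag(s) n(w) = n(w') diag(s)` and `diag(s) n(r) = n(λ r) diag(s)`
    have h1 : glDiagonal 2 _ s * Matrix.GeneralLinearGroup.upperRightHom w =
        Matrix.GeneralLinearGroup.upperRightHom w' * glDiagonal 2 _ s := glDiagonal_mul_upperRightHom s w
    have h2 : glDiagonal 2 _ s * Matrix.GeneralLinearGroup.upperRightHom r =
        Matrix.GeneralLinearGroup.upperRightHom (((s 0 * (s 1)⁻¹ : (FiniteAdeleRing (𝓞 K) K)ˣ) :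
            FiniteAdeleRing (𝓞 K) K) * r) * glDiagonal 2 _ s := by
      rw [glDiagonal_mul_upperRightHom, Units.val_mul, mul_right_comm]
    have hsprod : glDiagonal 2 (FiniteAdeleRing (𝓞 K) K) s =
        glDiagonal 2 _ ![tx, ty] * glDiagonal 2 _ ![vx, vy] := by rw [hs, map_mul]
    set Dk := glDiagonal 2 (FiniteAdeleRing (𝓞 K) K)
      (fun i => IsDedekindDomain.FiniteAdeleRing.unitEmbedding (𝓞 K) K (![kx, ky] i)) with hDk
    calc Dk * glDiagonal 2 _ s * Matrix.GeneralLinearGroup.upperRightHom w * kk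
        = Dk * (glDiagonal 2 _ s * Matrix.GeneralLinearGroup.upperRightHom w) * kk := by
          simp only [mul_assoc]
      _ = Dk * (Matrix.GeneralLinearGroup.upperRightHom (algebraMap K (FiniteAdeleRing (𝓞 K) K) β) *
            (Matrix.GeneralLinearGroup.upperRightHom (((s 0 * (s 1)⁻¹ : (FiniteAdeleRing (𝓞 K) K)ˣ) :
              FiniteAdeleRing (𝓞 K) K) * r) * glDiagonal 2 _ s)) * kk := by
          rw [h1, hn]; simp only [mul_assoc]
      _ = Dk * (Matrix.GeneralLinearGroup.upperRightHom (algebraMap K (FiniteAdeleRing (𝓞 K) K) β) *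
            (glDiagonal 2 _ s * Matrix.GeneralLinearGroup.upperRightHom r)) * kk := by rw [h2]
      _ = _ := by rw [hsprod]; simp only [mul_assoc]

end BigHeckeGLn

/-! ### Finitely many Borel orbits on `GL₂(𝔸_F^∞) / K_f(𝔫)` -/

namespace ParallelWeight

open BigHeckeGLn

variable {F : Type} [Field F] [NumberField F]

/-- **Finitely many cusps, adelically**: for `𝔫 ≠ 0` there is a finite family of points
`diag(t) c K_f(𝔫)` (`c ∈ GL₂(𝒪̂_F)`) meeting every `B(F)`-orbit on `GL₂(𝔸_F^∞) / K_f(𝔫)`.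
[cite: Harder1987, §2] -/
theorem exists_finite_cover_borelOrbits {𝔫 : Ideal (𝓞 F)} (h𝔫 : 𝔫 ≠ 0) :
    ∃ s₀ : Finset (FiniteAdelicGL 2 F ⧸ (principalCongruenceLevel 2 F 𝔫).comap (GLn.ofFinite 2 F)),
      (∀ x ∈ s₀, ∃ t : Fin 2 → (FiniteAdeleRing (𝓞 F) F)ˣ, ∃ c ∈ glFiniteIntegralLevel 2 F,
        x = ((glDiagonal 2 (FiniteAdeleRing (𝓞 F) F) t * c : FiniteAdelicGL 2 F) :
          FiniteAdelicGL 2 F ⧸ (principalCongruenceLevel 2 F 𝔫).comap (GLn.ofFinite 2 F))) ∧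
      ∀ y : FiniteAdelicGL 2 F ⧸ (principalCongruenceLevel 2 F 𝔫).comap (GLn.ofFinite 2 F),
        ∃ x ∈ s₀, ∃ γ : borel F, ((globalEmbedding 2 F).comp (borel F).subtype) γ • x = y := by
  classical
  set L := (principalCongruenceLevel 2 F 𝔫).comap (GLn.ofFinite 2 F) with hL
  set M := glFiniteIntegralLevel 2 F with hM
  -- `K_f(𝔫) ∩ GL₂(𝒪̂)` has finite index in the compact `GL₂(𝒪̂)`
  haveI hfi : (L.subgroupOf M).FiniteIndex :=
    Subgroup.finiteIndex_subgroupOf_of_isCompact_isOpen (isCompact_glFiniteIntegralLevel_holds 2 F)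
      (isOpen_comap_ofFinite_principalCongruenceLevel 2 F h𝔫)
  haveI : Fintype (M ⧸ L.subgroupOf M) := Subgroup.fintypeQuotientOfFiniteIndex
  -- coset representatives
  let C : Finset M := Finset.univ.image fun q : M ⧸ L.subgroupOf M => q.out
  have hC : ∀ c' ∈ M, ∃ c₀ ∈ C, ((c₀ : M) : FiniteAdelicGL 2 F)⁻¹ * c' ∈ L := by
    intro c' hc'
    refine ⟨((⟨c', hc'⟩ : M) : M ⧸ L.subgroupOf M).out, Finset.mem_image_of_mem _ (Finset.mem_univ _), ?_⟩
    have h := QuotientGroup.out_eq' (s := L.subgroupOf M) ((⟨c', hc'⟩ : M) : M ⧸ L.subgroupOf M)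
    rw [QuotientGroup.eq, Subgroup.mem_subgroupOf] at h
    simpa using h
  obtain ⟨T, hT⟩ := exists_borel_mul_glDiagonal_mul_eq (K := F)
  refine ⟨((T ×ˢ T) ×ˢ C).image fun p =>
      ((glDiagonal 2 (FiniteAdeleRing (𝓞 F) F) ![p.1.1, p.1.2] * ((p.2 : M) : FiniteAdelicGL 2 F) :
        FiniteAdelicGL 2 F) : FiniteAdelicGL 2 F ⧸ L), ?_, fun y => ?_⟩
  · intro x hx
    obtain ⟨p, -, rfl⟩ := Finset.mem_image.1 hx
    exact ⟨_, _, p.2.2, rfl⟩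
  · induction y using QuotientGroup.induction_on with
    | H g =>
    obtain ⟨γ, hγ, t₀, ht₀, t₁, ht₁, c', hc', hg⟩ := hT g
    obtain ⟨c₀, hc₀, hl⟩ := hC c' hc'
    refine ⟨_, Finset.mem_image_of_mem _ (Finset.mk_mem_product (Finset.mk_mem_product ht₀ ht₁) hc₀),
      ⟨γ, (mem_borel_iff γ).2 hγ⟩, ?_⟩
    rw [MonoidHom.comp_apply, Subgroup.coe_subtype, MulAction.Quotient.smul_coe, smul_eq_mul,
      QuotientGroup.eq, hg]
    simpa [mul_assoc] using hl

end ParallelWeight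

end Literature.NumberTheory.Automorphic
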